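import Literature.Analysis.FluidPDE.NormalisedPressureL2Bound
import Literature.Analysis.FluidPDE.PressureRepresentation
import HarnessLib

/-!
# The `L²` bound for the normalised pressure of a smooth finite-energy field

Analysis/FluidPDE proofs-layer file (theorems only). The tree proves the Stein-type `L²` bound
`‖p̃[w]‖_{L²} ≤ 27 M_λ ‖|w|²‖_{L²}` for COMPACTLY SUPPORTED smooth fields `w ∈ C^∞_c(ℝ³; ℝ³)`
(`eLpNorm_normalisedPressure_le`, `NormalisedPressureL2Bound.lean`; `p̃` the normalised pressure
`-Δ⁻¹∂ᵢ∂ⱼ(wᵢwⱼ)` of Tao 2011, (35), `NormalisedPressure.lean`). The pressure of a classical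
finite-energy solution of Navier–Stokes is `p̃[u(t)] + C(t)` (Tao 2011, Lemma 4.1 (i), proved as
`tao_pressure_normalisation_holds`) with `u(t)` smooth, of finite energy, but NOT compactly
supported. This file extends the bound to that class:

* `eLpNorm_normalisedPressure_le_of_integrable` — for `w ∈ C^∞(ℝ³; ℝ³)` with `|w|² ∈ L¹`,
  `‖p̃[w]‖_{L²} ≤ 27 M_λ ‖|w|²‖_{L²}` (both sides may be `∞`);
* `aestronglyMeasurable_normalisedPressure_of_integrable` — `p̃[w]` is a.e. strongly measurable;
* `tendsto_normalisedPressure_cutoff` — `p̃[χ_R w](x) → p̃[w](x)` at every `x` along the smooth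
  cutoffs `χ_R = cutoff R` (`WholeSpaceIBP.lean`), `R = n + 1 → ∞`.

It serves the decomposition of `Literature.Analysis.FluidPDE.knss_no_axisymmetric_typeI` through
the local inputs of `AxisymmetricTypeIBounded.lean`: the ε-regularity and local axisymmetric
theorems there are printed for suitable weak solutions with pressure in `L^{3/2}` of cylinders
reaching the final time, where the classical pressure is only known through `p̃[u(t)]`.

## Proof

By the representation `p̃[v] = Q[v] = -Q₁[v] - Q₂[v]` for `v ∈ C²` with `|v|² ∈ L¹`
(`normalisedPressure_eq_pressurePotential`, `PressureRepresentation.lean`): the near potential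
`Q₁[v](x) = ∫ Γ₀(z) G[v](x - z) dz` only sees `v` on `B(x, 2)` (`Γ₀` is supported in `|z| ≤ 2`),
so `Q₁[χ_R w](x) = Q₁[w](x)` as soon as `R ≥ |x| + 3`; the far potential
`Q₂[v](x) = ∫ D²Γ∞(x - y)(v y, v y) dy` has a bounded kernel, so `Q₂[χ_R w](x) → Q₂[w](x)` by
dominated convergence (`χ_R² |w|² ≤ |w|² ∈ L¹`, `χ_R → 1`). Hence `p̃[χ_n w] → p̃[w]` pointwise,
and Fatou's lemma in the form `‖lim fₙ‖_{L²} ≤ liminf ‖fₙ‖_{L²}`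
(`MeasureTheory.Lp.eLpNorm_lim_le_liminf_eLpNorm`) with the compactly supported bound applied to
each `χ_n w` (and `‖|χ_n w|²‖_{L²} ≤ ‖|w|²‖_{L²}`) gives the claim with the same constant.

## Mathlib / tree search

Mathlib: `tendsto_integral_of_dominated_convergence`, `Lp.eLpNorm_lim_le_liminf_eLpNorm`,
`aestronglyMeasurable_of_tendsto_ae`, `eLpNorm_mono`. Tree: `eLpNorm_normalisedPressure_le`,
`aestronglyMeasurable_normalisedPressure` (compact support), `cutoff`, `cutoff_eq_one`,
`tendsto_cutoff_natCast_add_one`, `contDiff_cutoff`, `hasCompactSupport_cutoff` (`WholeSpaceIBP`),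
`nearPotential`, `farPotential`, `pressurePotential`, `newtonNear_eq_zero`,
`exists_bounds_fderiv2_newtonFar`, `contDiff_fderiv2_newtonFar`,
`normalisedPressure_eq_pressurePotential` (`PressureRepresentation`). The locality of the
quadratic source `G[v]` (`pressureSource_congr_of_eventuallyEq`) is proved in
`TsaiLocalPressure.lean`, whose imports are heavier than this file's; it is re-proved privately.
No general (non compactly supported) `L²` bound for `p̃` was in the tree
(`lean search 'eLpNorm_normalisedPressure'`).

## References

* T. Tao, *Localisation and compactness properties of the Navier–Stokes global regularity
  problem*, Anal. PDE 6 (2013), (35), Lemma 4.1. [Tao2011]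
* E. M. Stein, *Singular integrals and differentiability properties of functions* (1970),
  Ch. II §4.2, Thm 3. [Stein1971]
-/

noncomputable section

open MeasureTheory Set Function Filter Topology Metric
open scoped ENNReal NNReal ContDiff

namespace Literature.Analysis.FluidPDE

-- nested operator types `ℝ³ →L[ℝ] ℝ³ →L[ℝ] ℝ³ →L[ℝ] ℝ`
set_option maxSynthPendingDepth 3

/-- Local notation for physical space `ℝ³ = EuclideanSpace ℝ (Fin 3)`. -/
local notation "ℝ³" => EuclideanSpace ℝ (Fin 3)

section Cutoff

variable {w : ℝ³ → ℝ³}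

/-- The divergence only depends on the germ of the field (private copy of
`divergence_congr_of_eventuallyEq`, `TsaiLocalPressure.lean`). [folklore] -/
private theorem divergence_congr {f g : ℝ³ → ℝ³} {x : ℝ³} (h : f =ᶠ[𝓝 x] g) :
    VectorCalculus.divergence f x = VectorCalculus.divergence g x := by
  simp only [VectorCalculus.divergence, h.fderiv_eq]

/-- The quadratic source `G[v] = div((v·∇)v + (div v) v)` only depends on the germ of `v`
(private copy of `pressureSource_congr_of_eventuallyEq`, `TsaiLocalPressure.lean`). [folklore] -/
private theorem pressureSource_congr {v v' : ℝ³ → ℝ³} {x : ℝ³} (h : v =ᶠ[𝓝 x] v') :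
    pressureSource v x = pressureSource v' x := by
  have hD : fderiv ℝ v =ᶠ[𝓝 x] fderiv ℝ v' := h.fderiv
  have hdiv : VectorCalculus.divergence v =ᶠ[𝓝 x] VectorCalculus.divergence v' := by
    filter_upwards [hD] with y hy
    simp only [VectorCalculus.divergence, hy]
  have hfield : (fun y => convect v v y + VectorCalculus.divergence v y • v y) =ᶠ[𝓝 x]
      fun y => convect v' v' y + VectorCalculus.divergence v' y • v' y := by
    filter_upwards [h, hD, hdiv] with y hy hDy hdivy
    simp only [convect, hy, hDy, hdivy]
  unfold pressureSource
  exact divergence_congr hfield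

/-- The cut-off fields `χ_R w` are smooth. [folklore] -/
theorem contDiff_cutoff_smul (hw : ContDiff ℝ ∞ w) (R : ℝ) :
    ContDiff ℝ ∞ fun y : ℝ³ => cutoff R y • w y :=
  (contDiff_cutoff (n := ⊤) R).smul hw

/-- The cut-off fields `χ_R w`, `R > 0`, are compactly supported. [folklore] -/
theorem hasCompactSupport_cutoff_smul {R : ℝ} (hR : 0 < R) :
    HasCompactSupport fun y : ℝ³ => cutoff R y • w y :=
  (hasCompactSupport_cutoff hR).smul_right

/-- `|χ_R w| ≤ |w|` pointwise. [folklore] -/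
theorem norm_cutoff_smul_le (R : ℝ) (y : ℝ³) : ‖cutoff R y • w y‖ ≤ ‖w y‖ := by
  rw [norm_smul, Real.norm_of_nonneg (cutoff_nonneg R y)]
  exact mul_le_of_le_one_left (norm_nonneg _) (cutoff_le_one R y)

/-- `|χ_R w|² ∈ L¹` when `|w|² ∈ L¹`. [folklore] -/
theorem integrable_norm_cutoff_smul_sq (hw : Continuous w) (hL2 : Integrable fun y => ‖w y‖ ^ 2)
    (R : ℝ) : Integrable fun y : ℝ³ => ‖cutoff R y • w y‖ ^ 2 := by
  refine hL2.mono (((contDiff_cutoff (n := 0) R).continuous.smul hw).norm.pow 2).aestronglyMeasurable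
    (Eventually.of_forall fun y => ?_)
  rw [Real.norm_of_nonneg (sq_nonneg _), Real.norm_of_nonneg (sq_nonneg _)]
  exact pow_le_pow_left₀ (norm_nonneg _) (norm_cutoff_smul_le R y) 2

/-- **The near potential only sees a bounded neighbourhood**: `Q₁[χ_{n+1} w](x) = Q₁[w](x)` for
all `n` with `n + 1 ≥ |x| + 3` (the kernel `Γ₀ = Γ₀^{1,2}` vanishes for `|z| ≥ 2`, and on
`B(x, 2)` the fields `χ_{n+1} w` and `w` have the same germ). [folklore] -/
theorem nearPotential_cutoff_eventually_eq (x : ℝ³) :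
    ∀ᶠ n : ℕ in atTop, nearPotential 1 2 (fun y => cutoff ((n : ℝ) + 1) y • w y) x =
      nearPotential 1 2 w x := by
  have hev : ∀ᶠ n : ℕ in atTop, ‖x‖ + 3 ≤ (n : ℝ) + 1 :=
    (tendsto_natCast_atTop_atTop.atTop_add tendsto_const_nhds).eventually_ge_atTop _
  filter_upwards [hev] with n hn
  refine integral_congr_ae (Eventually.of_forall fun z => ?_)
  show newtonNear 1 2 z * pressureSource (fun y => cutoff ((n : ℝ) + 1) y • w y) (x - z) =
    newtonNear 1 2 z * pressureSource w (x - z)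
  by_cases hz : 2 ≤ ‖z‖
  · simp only [newtonNear_eq_zero zero_le_one one_lt_two hz, zero_mul]
  · congr 1
    refine pressureSource_congr ?_
    -- on the ball `‖y‖ < n + 1` the cutoff is `1`
    have hR : (0 : ℝ) < (n : ℝ) + 1 := Nat.cast_add_one_pos n
    have hmem : x - z ∈ Metric.ball (0 : ℝ³) ((n : ℝ) + 1) := by
      rw [Metric.mem_ball, dist_zero_right]
      have : ‖x - z‖ ≤ ‖x‖ + ‖z‖ := norm_sub_le x z
      linarith [not_le.1 hz]
    filter_upwards [Metric.isOpen_ball.mem_nhds hmem] with y hy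
    rw [Metric.mem_ball, dist_zero_right] at hy
    rw [cutoff_eq_one hR hy.le, one_smul]

/-- **The far potential of the cut-off fields converges**: `Q₂[χ_{n+1} w](x) → Q₂[w](x)`
(dominated convergence against the bounded kernel `D²Γ∞`, `χ² |w|² ≤ |w|² ∈ L¹`, `χ → 1`).
[folklore] -/
theorem tendsto_farPotential_cutoff (hw : Continuous w) (hL2 : Integrable fun y => ‖w y‖ ^ 2)
    (x : ℝ³) :
    Tendsto (fun n : ℕ => farPotential 1 2 (fun y => cutoff ((n : ℝ) + 1) y • w y) x) atTop
      (𝓝 (farPotential 1 2 w x)) := by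
  obtain ⟨M₀, -, -, hM₀, -, -⟩ := exists_bounds_fderiv2_newtonFar one_pos one_lt_two
  set K : ℝ³ → ℝ³ →L[ℝ] ℝ³ →L[ℝ] ℝ := fun y => fderiv ℝ (fderiv ℝ (newtonFar 1 2)) (x - y) with hK
  have hKc : Continuous K :=
    (contDiff_fderiv2_newtonFar one_pos one_lt_two).continuous.comp (continuous_const.sub continuous_id)
  -- the integrands
  have hF : ∀ n : ℕ, (fun y => K y (cutoff ((n : ℝ) + 1) y • w y) (cutoff ((n : ℝ) + 1) y • w y)) =
      fun y => cutoff ((n : ℝ) + 1) y ^ 2 * K y (w y) (w y) := by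
    intro n
    funext y
    simp only [map_smul, FunLike.coe_smul, Pi.smul_apply, smul_eq_mul]
    ring
  show Tendsto (fun n : ℕ => ∫ y, K y (cutoff ((n : ℝ) + 1) y • w y) (cutoff ((n : ℝ) + 1) y • w y))
    atTop (𝓝 (∫ y, K y (w y) (w y)))
  simp_rw [hF]
  refine tendsto_integral_of_dominated_convergence (fun y => M₀ * ‖w y‖ ^ 2) ?_ ?_ ?_ ?_
  · intro n
    exact ((((contDiff_cutoff (n := 0) ((n : ℝ) + 1)).continuous.pow 2).mul
      ((hKc.clm_apply hw).clm_apply hw))).aestronglyMeasurable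
  · exact hL2.const_mul M₀
  · intro n
    refine Eventually.of_forall fun y => ?_
    rw [Real.norm_eq_abs, abs_mul, abs_of_nonneg (sq_nonneg _)]
    have h1 : cutoff ((n : ℝ) + 1) y ^ 2 ≤ 1 := by
      have := cutoff_le_one ((n : ℝ) + 1) y
      have := cutoff_nonneg ((n : ℝ) + 1) y
      nlinarith
    have h2 : |K y (w y) (w y)| ≤ M₀ * ‖w y‖ ^ 2 := by
      calc |K y (w y) (w y)| ≤ ‖K y (w y)‖ * ‖w y‖ := by
            rw [← Real.norm_eq_abs]; exact ContinuousLinearMap.le_opNorm _ _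
        _ ≤ ‖K y‖ * ‖w y‖ * ‖w y‖ := by gcongr; exact ContinuousLinearMap.le_opNorm _ _
        _ ≤ M₀ * ‖w y‖ * ‖w y‖ := by gcongr; exact hM₀ _
        _ = M₀ * ‖w y‖ ^ 2 := by ring
    calc cutoff ((n : ℝ) + 1) y ^ 2 * |K y (w y) (w y)|
        ≤ 1 * (M₀ * ‖w y‖ ^ 2) := by gcongr
      _ = M₀ * ‖w y‖ ^ 2 := one_mul _
  · refine Eventually.of_forall fun y => ?_
    have h1 : Tendsto (fun n : ℕ => cutoff ((n : ℝ) + 1) y ^ 2) atTop (𝓝 1) := by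
      simpa using (tendsto_cutoff_natCast_add_one y).pow 2
    simpa using h1.mul_const (K y (w y) (w y))

/-- **Pointwise convergence of the normalised pressures of the cut-off fields**:
`p̃[χ_{n+1} w](x) → p̃[w](x)` for `w ∈ C^∞` with `|w|² ∈ L¹`. [folklore] -/
theorem tendsto_normalisedPressure_cutoff (hw : ContDiff ℝ ∞ w)
    (hL2 : Integrable fun y => ‖w y‖ ^ 2) (x : ℝ³) :
    Tendsto (fun n : ℕ => normalisedPressure (fun y => cutoff ((n : ℝ) + 1) y • w y) x) atTop
      (𝓝 (normalisedPressure w x)) := by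
  have hw2 : ContDiff ℝ 2 w := hw.of_le (by norm_cast)
  have hwn2 : ∀ n : ℕ, ContDiff ℝ 2 fun y => cutoff ((n : ℝ) + 1) y • w y := fun n =>
    (contDiff_cutoff_smul hw _).of_le (by norm_cast)
  have hLn : ∀ n : ℕ, Integrable fun y => ‖cutoff ((n : ℝ) + 1) y • w y‖ ^ 2 := fun n =>
    integrable_norm_cutoff_smul_sq hw.continuous hL2 _
  rw [normalisedPressure_eq_pressurePotential hw2 hL2 x]
  have heq : (fun n : ℕ => normalisedPressure (fun y => cutoff ((n : ℝ) + 1) y • w y) x) =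
      fun n : ℕ => pressurePotential (fun y => cutoff ((n : ℝ) + 1) y • w y) x :=
    funext fun n => normalisedPressure_eq_pressurePotential (hwn2 n) (hLn n) x
  rw [heq]
  simp only [pressurePotential]
  refine Tendsto.sub ?_ (tendsto_farPotential_cutoff hw.continuous hL2 x)
  refine (tendsto_const_nhds (x := -nearPotential 1 2 w x)).congr' ?_
  filter_upwards [nearPotential_cutoff_eventually_eq (w := w) x] with n hn
  rw [hn]

/-- **Measurability of `p̃[w]`** for `w ∈ C^∞` with `|w|² ∈ L¹` (pointwise limit of the
measurable `p̃[χ_{n+1} w]`). [folklore] -/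
theorem aestronglyMeasurable_normalisedPressure_of_integrable (hw : ContDiff ℝ ∞ w)
    (hL2 : Integrable fun y => ‖w y‖ ^ 2) :
    AEStronglyMeasurable (normalisedPressure w) volume :=
  aestronglyMeasurable_of_tendsto_ae (atTop : Filter ℕ)
    (fun n : ℕ => aestronglyMeasurable_normalisedPressure (contDiff_cutoff_smul hw _)
      (hasCompactSupport_cutoff_smul (Nat.cast_add_one_pos n)))
    (ae_of_all _ fun x => tendsto_normalisedPressure_cutoff hw hL2 x)

/-- **The `L²` bound for the normalised pressure of a smooth finite-energy field**: for
`w ∈ C^∞(ℝ³; ℝ³)` with `|w|² ∈ L¹`, `‖p̃[w]‖_{L²} ≤ 27 M_λ ‖|w|²‖_{L²}` — the constant of the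
compactly supported bound `eLpNorm_normalisedPressure_le` (Stein 1970, Ch. II §4.2 Thm 3 for the
Riesz-type kernel of `p̃`), by cut-off, pointwise convergence and Fatou. Both sides may be
infinite. [cite: Stein1971, Ch. II §4.2 Thm 3] -/
theorem eLpNorm_normalisedPressure_le_of_integrable (hw : ContDiff ℝ ∞ w)
    (hL2 : Integrable fun y => ‖w y‖ ^ 2) :
    eLpNorm (normalisedPressure w) 2 volume ≤
      ENNReal.ofReal (27 * regLaplacianMass) * eLpNorm (fun y => ‖w y‖ ^ 2) 2 volume := by
  set f : ℕ → ℝ³ → ℝ := fun n => normalisedPressure (fun y => cutoff ((n : ℝ) + 1) y • w y) with hf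
  have hmeas : ∀ n, AEStronglyMeasurable (f n) volume := fun n =>
    aestronglyMeasurable_normalisedPressure (contDiff_cutoff_smul hw _)
      (hasCompactSupport_cutoff_smul (Nat.cast_add_one_pos n))
  have hlim : ∀ᵐ x ∂(volume : Measure ℝ³), Tendsto (fun n => f n x) atTop
      (𝓝 (normalisedPressure w x)) :=
    ae_of_all _ fun x => tendsto_normalisedPressure_cutoff hw hL2 x
  refine (MeasureTheory.Lp.eLpNorm_lim_le_liminf_eLpNorm hmeas _ hlim).trans ?_
  refine liminf_le_of_frequently_le' (Eventually.of_forall fun n => ?_).frequently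
  calc eLpNorm (f n) 2 volume
      ≤ ENNReal.ofReal (27 * regLaplacianMass) *
          eLpNorm (fun y => ‖cutoff ((n : ℝ) + 1) y • w y‖ ^ 2) 2 volume :=
        eLpNorm_normalisedPressure_le (contDiff_cutoff_smul hw _)
          (hasCompactSupport_cutoff_smul (Nat.cast_add_one_pos n))
    _ ≤ ENNReal.ofReal (27 * regLaplacianMass) * eLpNorm (fun y => ‖w y‖ ^ 2) 2 volume := by
        gcongr
        refine eLpNorm_mono_real fun y => ?_
        rw [Real.norm_of_nonneg (sq_nonneg _)]
        exact pow_le_pow_left₀ (norm_nonneg _) (norm_cutoff_smul_le _ y) 2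

end Cutoff

end Literature.Analysis.FluidPDE

end
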